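import Literature.NumberTheory.Sieve.NumberFieldLargeSieve
import Literature.NumberTheory.Sieve.BoxPrimesCharacterSums
import Literature.NumberTheory.LFunctions.RayClassGaussSumNorm
import Literature.NumberTheory.LFunctions.RayClassOrbitSums
import HarnessLib

/-!
# The large sieve inequality for the characters of `(𝓞_K/𝔮)ˣ` of a totally real field (Hinz (3.1))

Topic `Literature/NumberTheory/Sieve`; namespace `Literature.NumberTheory.Sieve.NumberFieldLS`
(continuing `NumberFieldLargeSieve.lean`).  Everything in this file is PROVED (theorems; the
definitions have bodies; no named facts).

**The printed result** (J. G. Hinz, *A generalization of Bombieri's prime number theorem to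
algebraic number fields*, Acta Arith. 51 (1988), §3 (3.1), quoting J. G. Hinz, *Methoden des großen
Siebes in algebraischen Zahlkörpern*, Manuscripta Math. 57 (1987)): for an integral ideal `𝔞`,
`Q ≥ 1`, a box `ℜ` and complex `c(α)`,

  `∑_{N𝔮 ≤ Q} (N𝔮/Φ(𝔮)) ∑*_{χ mod 𝔮} |∑'_{α ∈ ℜ} c(α) χ(α)|² ≪ (Q² + x/N𝔞) ∑'_{α ∈ ℜ} |c(α)|²`,

`∑*` over the primitive characters of `(𝓞_K/𝔮)ˣ`, `∑'` over the `α ∈ ℜ` divisible by `𝔞`, `x` the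
volume parameter of the box.  (For `𝔞 = 𝓞_K` this is the multiplicative form of M. N. Huxley,
*The large sieve inequality for algebraic number fields*, Mathematika 15 (1968), Theorem 2.)

**What is proved here** (general number field `K` for the algebra, totally real for the sieve):

* `IsPrimitiveChar 𝔮 χ` — a character `χ` of `(𝓞_K/𝔮)ˣ` (an `AddChar (Additive ((𝓞 K ⧸ 𝔮)ˣ)) ℂ`,
  extended by `0` through `BoxPrimes.unitValue`) is primitive: it does not factor through
  `(𝓞_K/𝔣)ˣ` for any `𝔮 ⊊ 𝔣`;
* Gauss sums `charGaussSum 𝔮 χ y = ∑_{x mod 𝔮} χ(x) e(Tr(xy))` for `y ∈ 𝔮⁻¹𝔡⁻¹` and their theory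
  for primitive `χ` (the proofs of Neukirch VII (6.4) of the tree's `RayClassGaussSum[Norm].lean`,
  re-run for arbitrary characters of `(𝓞_K/𝔮)ˣ` instead of finite parts of ray class characters):
  `charGaussSum_mul` (`χ(a) τ(χ̄, y) = τ(χ̄, ay)` for ALL `a`), `normSq_charGaussSum`
  (`|τ(χ, y)|² = N𝔮` when `y𝔮𝔡` is an integral ideal prime to `𝔮`);
* `exists_exactDenom` — for `𝔮 ≠ 0` an element `y ∈ 𝔮⁻¹𝔡⁻¹` with `y𝔮𝔡` integral and prime to `𝔮`
  (an additive character of `𝓞_K/𝔮` of exact denominator `𝔮`), from the tree's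
  `exists_mem_eltIdeal_isCoprime`; `mul_sub_mul_notMem_inv` — the **spacing of the Farey points of
  `K`**: for `(𝔮, u) ≠ (𝔮', u')` (`u, u'` unit classes, `𝔮, 𝔮'` prime to `𝔞`) and `λ ∈ 𝔞⁻¹`,
  `β = u y_𝔮 − u' y_𝔮' − λ` is a NONZERO element of `(𝔮𝔮'𝔞𝔡)⁻¹`, hence `|N β| ≥ (N𝔮N𝔮'N𝔞|d_K|)⁻¹`
  and some `|σ_w β| ≥ (N𝔮 N𝔮' N𝔞 |d_K|)^{-1/d}`;
* `sum_primitive_le_sum_units` — Gallagher's passage from multiplicative to additive characters: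
  `(N𝔮/φ(𝔮)) ∑*_χ |∑_α c(α)χ(α)|² ≤ ∑_{u ∈ (𝓞/𝔮)ˣ} |∑_α c(α) e(Tr(α u y_𝔮))|²`;
* **`multiplicativeLargeSieve`** — Hinz's (3.1) for a totally real field and cube boxes: there is
  `C = C(K)` such that for all `Q ≥ 1`, nonzero `𝔞`, finite `S ⊆ 𝔞` in a cube of side `2X₀`
  with `N𝔞 ≤ X₀^d`, and all `c`,
  `∑_{N𝔮 ≤ Q, (𝔮,𝔞)=1} (N𝔮/φ(𝔮)) ∑*_χ |∑_{α∈S} c(α)χ(α)|² ≤ C (Q² + X₀^d/N𝔞) ∑_{α∈S} |c(α)|²`.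
  (Moduli `𝔮` not prime to `𝔞` contribute nothing when the coefficients live on `𝔞`, since then
  `χ(α) = 0`; they are simply omitted from the sum.)

## References

* J. G. Hinz, Acta Arith. 51 (1988), 173–193, §3 (3.1). [Hinz1988]
* J. G. Hinz, Manuscripta Math. 57 (1987), 181–194. [Hinz1987]
* M. N. Huxley, Mathematika 15 (1968), 178–187, Theorem 2. [Huxley1968]
* J. Neukirch, *Algebraic Number Theory*, VII §6 (6.3)–(6.4) (Gauss sums over `𝓞/𝔪`). [NeukirchANT1999]

## Mathlib / tree search

Tree: `NumberFieldLS.additiveLargeSieve_cube`, `remb`, `exists_rpow_le_abs_remb` (previous file);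
`BoxPrimes.unitValue` (+ `_coe`, `_of_not_isUnit`), `BoxPrimes.sum_char_inv_mul` (orthogonality);
`LFunctions.liftNZ`, `exists_not_mem_mul_mem`, `coe_fourierChar_trace_add_of_mem`, `coe_mul_mem_dual`,
`sum_fourierChar_trace_eq_card/zero`, `mul_mem_dual_one_iff`, `mem_dual_of_coeIdeal_eq`
(`RayClassGaussSum[Norm]`); `LFunctions.eltIdeal`, `exists_mem_eltIdeal_isCoprime` (`RayClassOrbitSums`).
Mathlib: `FractionalIdeal.dual`, `dual_le_dual`, `coeIdeal_differentIdeal`, `absNorm_differentIdeal`,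
`AddChar`, `Ideal.fintypeQuotientOfFreeOfNeBot`.
-/

noncomputable section

open Complex Finset NumberField NumberField.InfinitePlace IsDedekindDomain
open scoped Real ComplexConjugate nonZeroDivisors Classical FourierTransform

namespace Literature.NumberTheory.Sieve.NumberFieldLS

open Literature.NumberTheory.LFunctions.VdC (e norm_e e_add e_zero e_neg e_add_int)
open Literature.NumberTheory.LFunctions (liftNZ liftNZ_ne_zero mk_liftNZ exists_not_mem_mul_mem
  coe_fourierChar_trace_add_of_mem exists_int_eq_trace_of_mem_dual coe_mul_mem_dual
  sum_fourierChar_trace_eq_card sum_fourierChar_trace_eq_zero mul_mem_dual_one_iff mem_dual_of_coeIdeal_eq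
  coeIdeal_ne_zero' coeIdeal_differentIdeal_ne_zero dual_coeIdeal_eq eltIdeal coe_eltIdeal coe_eltIdeal_mul
  exists_mem_eltIdeal_isCoprime)
open Literature.NumberTheory.Sieve.BoxPrimes (unitValue unitValue_coe unitValue_of_not_isUnit
  unitValue_zero_of_isUnit norm_unitValue_le)
open Literature.NumberTheory.LFunctions.AbelianDensity (toMulHom toMulHom_apply)

variable {K : Type*} [Field K] [NumberField K]

/-! ## The two normalisations of `e(t)` -/

/-- `e(t) = 𝐞(t)` (the tree's `VdC.e` and Mathlib's `Real.fourierChar`). [folklore] -/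
theorem e_eq_coe_fourierChar (t : ℝ) : e t = ((𝐞 t : Circle) : ℂ) := by
  rw [Literature.NumberTheory.LFunctions.VdC.e, Real.fourierChar_apply]

/-- The different is a nonzero ideal. [folklore] -/
private theorem differentIdeal_ne_bot' : differentIdeal ℤ (𝓞 K) ≠ ⊥ :=
  FractionalIdeal.coeIdeal_ne_zero.1 (coeIdeal_differentIdeal_ne_zero (K := K))

/-! ## Primitive characters of `(𝓞_K/𝔮)ˣ` -/

/-- **Primitive character of `(𝓞_K/𝔮)ˣ`**: `χ` does not factor through `(𝓞_K/𝔣)ˣ` for any ideal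
`𝔣 ⊋ 𝔮`, i.e. for every such `𝔣` some unit class `b ≡ 1 mod 𝔣` has `χ(b) ≠ 1` (Neukirch VII §6:
"`χ_f` … does not factorize through `(𝒪/𝔪')^*` for any proper divisor `𝔪' ∣ 𝔪`").
[cite: NeukirchANT1999, Ch. VII §6, before Def. (6.3)] -/
structure IsPrimitiveChar (𝔮 : Ideal (𝓞 K)) (χ : AddChar (Additive ((𝓞 K ⧸ 𝔮)ˣ)) ℂ) : Prop where
  /-- `χ` is nontrivial on the kernel of `(𝓞/𝔮)ˣ → (𝓞/𝔣)ˣ` for every `𝔮 ⊊ 𝔣`. -/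
  exists_ne_one : ∀ 𝔣 : Ideal (𝓞 K), 𝔮 ≤ 𝔣 → 𝔣 ≠ 𝔮 →
    ∃ b : 𝓞 K, IsUnit (Ideal.Quotient.mk 𝔮 b) ∧ b - 1 ∈ 𝔣 ∧ unitValue χ (Ideal.Quotient.mk 𝔮 b) ≠ 1

/-! ## Character values: conjugation and multiplicativity -/

section Values

variable {𝔮 : Ideal (𝓞 K)}

omit [NumberField K] in
/-- `χ(x)` is multiplicative on `𝓞/𝔮` (with the extension by `0`). [folklore] -/
theorem unitValue_mul (χ : AddChar (Additive ((𝓞 K ⧸ 𝔮)ˣ)) ℂ) (x y : 𝓞 K ⧸ 𝔮) :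
    unitValue χ (x * y) = unitValue χ x * unitValue χ y := by
  by_cases hx : IsUnit x
  · by_cases hy : IsUnit y
    · obtain ⟨u, rfl⟩ := hx
      obtain ⟨v, rfl⟩ := hy
      rw [← Units.val_mul, unitValue_coe, unitValue_coe, unitValue_coe]
      rw [toMulHom_apply, toMulHom_apply, toMulHom_apply, ofMul_mul, AddChar.map_add_eq_mul]
    · rw [unitValue_of_not_isUnit χ hy, mul_zero, unitValue_of_not_isUnit]
      exact fun h => hy (isUnit_of_mul_isUnit_right h)
  · rw [unitValue_of_not_isUnit χ hx, zero_mul, unitValue_of_not_isUnit]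
    exact fun h => hx (isUnit_of_mul_isUnit_left h)

omit [NumberField K] in
/-- The conjugate character: `χ̄(x) = conj χ(x)` where `χ̄ = -χ` in the additive notation of
`AddChar` (values on the unit circle). [folklore] -/
theorem unitValue_neg [Finite ((𝓞 K ⧸ 𝔮)ˣ)] (χ : AddChar (Additive ((𝓞 K ⧸ 𝔮)ˣ)) ℂ) (x : 𝓞 K ⧸ 𝔮) :
    unitValue (-χ) x = conj (unitValue χ x) := by
  by_cases hx : IsUnit x
  · obtain ⟨u, rfl⟩ := hx
    rw [unitValue_coe, unitValue_coe, toMulHom_apply, toMulHom_apply, AddChar.neg_apply,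
      AddChar.map_neg_eq_conj]
  · rw [unitValue_of_not_isUnit _ hx, unitValue_of_not_isUnit _ hx, map_zero]

omit [NumberField K] in
/-- `|χ(u)| = 1` on units. [folklore] -/
theorem norm_unitValue_of_isUnit [Finite ((𝓞 K ⧸ 𝔮)ˣ)] (χ : AddChar (Additive ((𝓞 K ⧸ 𝔮)ˣ)) ℂ)
    {x : 𝓞 K ⧸ 𝔮} (hx : IsUnit x) : ‖unitValue χ x‖ = 1 := by
  obtain ⟨u, rfl⟩ := hx
  rw [unitValue_coe, toMulHom_apply, AddChar.norm_apply]

omit [NumberField K] in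
/-- `conj χ(u) · χ(u) = 1` on units. [folklore] -/
theorem conj_unitValue_mul_self [Finite ((𝓞 K ⧸ 𝔮)ˣ)] (χ : AddChar (Additive ((𝓞 K ⧸ 𝔮)ˣ)) ℂ)
    {x : 𝓞 K ⧸ 𝔮} (hx : IsUnit x) : conj (unitValue χ x) * unitValue χ x = 1 := by
  rw [← Complex.normSq_eq_conj_mul_self, Complex.normSq_eq_norm_sq, norm_unitValue_of_isUnit χ hx]
  norm_num

end Values

/-! ## Gauss sums of characters of `(𝓞_K/𝔮)ˣ` -/

section Gauss

variable (𝔮 : Ideal (𝓞 K)) (χ : AddChar (Additive ((𝓞 K ⧸ 𝔮)ˣ)) ℂ)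

/-- The trace character `x ↦ 𝐞(Tr(x y))` on `𝓞_K`. [folklore] -/
def eTr (y : K) (x : 𝓞 K) : ℂ := ((𝐞 ((Algebra.trace ℚ K ((x : K) * y) : ℚ) : ℝ) : Circle) : ℂ)

/-- The general term `χ(x) 𝐞(Tr(xy))` of the Gauss sum. [cite: NeukirchANT1999, Ch. VII §6 Def. (6.3)] -/
def gaussTerm (y : K) (x : 𝓞 K) : ℂ := unitValue χ (Ideal.Quotient.mk 𝔮 x) * eTr y x

/-- **The Gauss sum `τ_𝔮(χ, y) = ∑_{x mod 𝔮} χ(x) 𝐞(Tr(xy))`** of a character `χ` of `(𝓞_K/𝔮)ˣ`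
(`y ∈ 𝔮⁻¹𝔡⁻¹`; summed over representatives, `charGaussSum_eq_sum`). Neukirch VII (6.3) for an
arbitrary character of `(𝒪/𝔮)^*`. [cite: NeukirchANT1999, Ch. VII §6 Def. (6.3)] -/
def charGaussSum (y : K) : ℂ := ∑ᶠ q : 𝓞 K ⧸ 𝔮, gaussTerm 𝔮 χ y (liftNZ K 𝔮 q)

variable {𝔮 χ}

/-- `eTr` is a character in `x`. [folklore] -/
theorem eTr_add (y : K) (x x' : 𝓞 K) : eTr y (x + x') = eTr y x * eTr y x' := by
  simp only [eTr, RingOfIntegers.coe_eq_algebraMap, map_add, add_mul, Rat.cast_add, AddChar.map_add_eq_mul,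
    Circle.coe_mul]

/-- `|eTr| = 1`. [folklore] -/
theorem norm_eTr (y : K) (x : 𝓞 K) : ‖eTr y x‖ = 1 := by
  rw [eTr, Circle.norm_coe]

/-- `conj eTr(x) · eTr(x) = 1`. [folklore] -/
theorem conj_eTr_mul_self (y : K) (x : 𝓞 K) : conj (eTr y x) * eTr y x = 1 := by
  rw [← Complex.normSq_eq_conj_mul_self, Complex.normSq_eq_norm_sq, norm_eTr]; norm_num

/-- `conj eTr(y, x) = eTr(y, -x)`. [folklore] -/
theorem conj_eTr (y : K) (x : 𝓞 K) : conj (eTr y x) = eTr y (-x) := by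
  have h1 := conj_eTr_mul_self y x
  have h2 : eTr y (-x) * eTr y x = 1 := by rw [← eTr_add, neg_add_cancel]; simp [eTr]
  have hne : eTr y x ≠ 0 := by
    intro h; rw [h, mul_zero] at h1; exact zero_ne_one h1
  exact mul_right_cancel₀ hne (h1.trans h2.symm)

/-- `eTr(αy, x) = eTr(y, αx)`. [folklore] -/
theorem eTr_mul_left (y : K) (α x : 𝓞 K) : eTr ((α : K) * y) x = eTr y (α * x) := by
  unfold eTr
  push_cast
  rw [mul_left_comm, mul_assoc]

/-- The term only depends on `x mod 𝔮` (`y ∈ 𝔮⁻¹𝔡⁻¹`). [cite: NeukirchANT1999, Ch. VII §6 Def. (6.3)] -/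
theorem gaussTerm_congr (h𝔮 : 𝔮 ≠ ⊥) {y : K}
    (hy : y ∈ FractionalIdeal.dual ℤ ℚ (𝔮 : FractionalIdeal (𝓞 K)⁰ K)) {x x' : 𝓞 K} (h : x - x' ∈ 𝔮) :
    gaussTerm 𝔮 χ y x = gaussTerm 𝔮 χ y x' := by
  rw [gaussTerm, gaussTerm, (Ideal.Quotient.eq).2 h]
  congr 1
  have : ((x : 𝓞 K) : K) = (x' : K) + ((x - x' : 𝓞 K) : K) := by push_cast; ring
  rw [eTr, eTr, this, coe_fourierChar_trace_add_of_mem h𝔮 hy _ h]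

/-- **The Gauss sum over any system of representatives.** [cite: NeukirchANT1999, Ch. VII §6 Def. (6.3)] -/
theorem charGaussSum_eq_sum [Fintype (𝓞 K ⧸ 𝔮)] (h𝔮 : 𝔮 ≠ ⊥) {y : K}
    (hy : y ∈ FractionalIdeal.dual ℤ ℚ (𝔮 : FractionalIdeal (𝓞 K)⁰ K))
    (r : 𝓞 K ⧸ 𝔮 → 𝓞 K) (hr : ∀ q, Ideal.Quotient.mk 𝔮 (r q) = q) :
    charGaussSum 𝔮 χ y = ∑ q, gaussTerm 𝔮 χ y (r q) := by
  rw [charGaussSum, finsum_eq_sum_of_fintype]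
  refine Finset.sum_congr rfl fun q _ => gaussTerm_congr h𝔮 hy ?_
  rw [← Ideal.Quotient.eq, mk_liftNZ h𝔮, hr]

/-- **(6.4), first case: `τ(χ, ay) = χ̄(a) τ(χ, y)` for `a` a unit `mod 𝔮`** (reindex `x ↦ xa`).
[cite: NeukirchANT1999, Ch. VII §6 Thm. (6.4)] -/
theorem charGaussSum_mul_of_isUnit (h𝔮 : 𝔮 ≠ ⊥) {a : 𝓞 K} (ha : IsUnit (Ideal.Quotient.mk 𝔮 a)) {y : K}
    (hy : y ∈ FractionalIdeal.dual ℤ ℚ (𝔮 : FractionalIdeal (𝓞 K)⁰ K)) :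
    charGaussSum 𝔮 χ ((a : K) * y) = conj (unitValue χ (Ideal.Quotient.mk 𝔮 a)) * charGaussSum 𝔮 χ y := by
  haveI : Finite (𝓞 K ⧸ 𝔮) := Ideal.finiteQuotientOfFreeOfNeBot 𝔮 h𝔮
  haveI : Fintype (𝓞 K ⧸ 𝔮) := Fintype.ofFinite _
  set u : (𝓞 K ⧸ 𝔮)ˣ := ha.unit with hu
  have huval : (u : 𝓞 K ⧸ 𝔮) = Ideal.Quotient.mk 𝔮 a := rfl
  have hr : ∀ q : 𝓞 K ⧸ 𝔮, Ideal.Quotient.mk 𝔮 (liftNZ K 𝔮 (q * u⁻¹) * a) = q := fun q => by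
    rw [map_mul, mk_liftNZ h𝔮, ← huval, Units.inv_mul_cancel_right]
  rw [charGaussSum_eq_sum h𝔮 (coe_mul_mem_dual hy a) (liftNZ K 𝔮) (mk_liftNZ h𝔮),
    charGaussSum_eq_sum h𝔮 hy _ hr, Finset.mul_sum]
  refine Fintype.sum_equiv (Units.mulRight u) _ _ fun q => ?_
  rw [Units.mulRight_apply, Units.mul_inv_cancel_right]
  simp only [gaussTerm]
  rw [map_mul, unitValue_mul]
  have hc := conj_unitValue_mul_self χ ha
  have he : eTr ((a : K) * y) (liftNZ K 𝔮 q) = eTr y (liftNZ K 𝔮 q * a) := by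
    simp only [eTr]; push_cast; ring_nf
  rw [he]
  linear_combination -(unitValue χ (Ideal.Quotient.mk 𝔮 (liftNZ K 𝔮 q)) * eTr y (liftNZ K 𝔮 q * a)) * hc

/-- **(6.4), second case: `τ(χ, ay) = 0` for `a` a non-unit `mod 𝔮` when `χ` is primitive**
(with `𝔣 = (𝔮 : a) ⊋ 𝔮`, `b ≡ 1 mod 𝔣`, `χ(b) ≠ 1`: `χ̄(b) τ(ay) = τ(bay) = τ(ay)`).
[cite: NeukirchANT1999, Ch. VII §6 Thm. (6.4)] -/
theorem charGaussSum_mul_eq_zero (hprim : IsPrimitiveChar 𝔮 χ) (h𝔮 : 𝔮 ≠ ⊥) {a : 𝓞 K}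
    (ha : ¬ IsUnit (Ideal.Quotient.mk 𝔮 a)) {y : K}
    (hy : y ∈ FractionalIdeal.dual ℤ ℚ (𝔮 : FractionalIdeal (𝓞 K)⁰ K)) :
    charGaussSum 𝔮 χ ((a : K) * y) = 0 := by
  have ha' : ¬ IsCoprime (Ideal.span {a}) 𝔮 :=
    fun h => ha (Literature.NumberTheory.LFunctions.isUnit_mk_of_isCoprime h)
  obtain ⟨z, hz, hza⟩ := exists_not_mem_mul_mem h𝔮 ha'
  set 𝔣 : Ideal (𝓞 K) := Submodule.colon 𝔮 ({a} : Set (𝓞 K)) with h𝔣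
  have hle : 𝔮 ≤ 𝔣 := fun m hm => by
    rw [h𝔣, Submodule.mem_colon_singleton, smul_eq_mul]; exact 𝔮.mul_mem_right _ hm
  have hne : 𝔣 ≠ 𝔮 := fun h => hz (by
    rw [← h, h𝔣, Submodule.mem_colon_singleton, smul_eq_mul]; exact hza)
  obtain ⟨b, hbu, hb1, hbne⟩ := hprim.exists_ne_one 𝔣 hle hne
  rw [h𝔣, Submodule.mem_colon_singleton, smul_eq_mul] at hb1
  have hbne' : conj (unitValue χ (Ideal.Quotient.mk 𝔮 b)) ≠ 1 := fun h => hbne (by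
    rw [← Complex.conj_conj (unitValue χ _), h, map_one])
  have hay : (a : K) * y ∈ FractionalIdeal.dual ℤ ℚ (𝔮 : FractionalIdeal (𝓞 K)⁰ K) := coe_mul_mem_dual hy a
  have h1 := charGaussSum_mul_of_isUnit (χ := χ) h𝔮 hbu hay
  have h2 : charGaussSum 𝔮 χ ((b : K) * ((a : K) * y)) = charGaussSum 𝔮 χ ((a : K) * y) := by
    refine finsum_congr fun q => ?_
    simp only [gaussTerm]
    congr 1
    simp only [eTr]
    have : ((liftNZ K 𝔮 q : 𝓞 K) : K) * ((b : K) * ((a : K) * y)) =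
        ((liftNZ K 𝔮 q : K) * ((a : K) * y)) + ((liftNZ K 𝔮 q * ((b - 1) * a) : 𝓞 K) : K) * y := by
      push_cast; ring
    rw [this]
    obtain ⟨n, hn⟩ := exists_int_eq_trace_of_mem_dual h𝔮 hy (𝔮.mul_mem_left (liftNZ K 𝔮 q) hb1)
    rw [map_add, ← hn, Rat.cast_add, Rat.cast_intCast,
      Literature.NumberTheory.LFunctions.coe_fourierChar_add_int]
  rw [h2] at h1
  have : (1 - conj (unitValue χ (Ideal.Quotient.mk 𝔮 b))) * charGaussSum 𝔮 χ ((a : K) * y) = 0 := by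
    linear_combination h1
  exact (mul_eq_zero.mp this).resolve_left (sub_ne_zero.mpr hbne'.symm)

/-- **Both cases of (6.4) at once: `τ(χ, ay) = χ̄(a) τ(χ, y)` for every `a`** (for a non-unit both
sides vanish). [cite: NeukirchANT1999, Ch. VII §6 Thm. (6.4)] -/
theorem charGaussSum_mul (hprim : IsPrimitiveChar 𝔮 χ) (h𝔮 : 𝔮 ≠ ⊥) (a : 𝓞 K) {y : K}
    (hy : y ∈ FractionalIdeal.dual ℤ ℚ (𝔮 : FractionalIdeal (𝓞 K)⁰ K)) :
    charGaussSum 𝔮 χ ((a : K) * y) = conj (unitValue χ (Ideal.Quotient.mk 𝔮 a)) * charGaussSum 𝔮 χ y := by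
  by_cases ha : IsUnit (Ideal.Quotient.mk 𝔮 a)
  · exact charGaussSum_mul_of_isUnit h𝔮 ha hy
  · rw [charGaussSum_mul_eq_zero hprim h𝔮 ha hy, unitValue_of_not_isUnit χ ha, map_zero, zero_mul]

omit [NumberField K] in
/-- `χ(1) = 1`. [folklore] -/
theorem unitValue_mk_one (χ : AddChar (Additive ((𝓞 K ⧸ 𝔮)ˣ)) ℂ) :
    unitValue χ (Ideal.Quotient.mk 𝔮 1) = 1 := by
  rw [map_one, show (1 : 𝓞 K ⧸ 𝔮) = ((1 : (𝓞 K ⧸ 𝔮)ˣ) : 𝓞 K ⧸ 𝔮) from rfl, unitValue_coe, toMulHom_apply,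
    ofMul_one, AddChar.map_zero_eq_one]

/-- **`|τ_𝔮(χ, y)|² = N𝔮` for primitive `χ` and `y` of exact denominator `𝔮`** (`y𝔮𝔡 = 𝔶`
integral with `(𝔶, 𝔮) = 1`): `conj τ · τ = ∑_z χ(z) ∑_x 𝐞(Tr(x(z−1)y))` and the inner sum is `N𝔮`
or `0` according as `z ≡ 1` or not (Neukirch VII (6.4), last clause, via (6.6)).
[cite: NeukirchANT1999, Ch. VII §6 Thm. (6.4)] -/
theorem normSq_charGaussSum (hprim : IsPrimitiveChar 𝔮 χ) (h𝔮 : 𝔮 ≠ ⊥) {y : K} {𝔶 : Ideal (𝓞 K)}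
    (h𝔶 : (𝔶 : FractionalIdeal (𝓞 K)⁰ K) = FractionalIdeal.spanSingleton (𝓞 K)⁰ y * 𝔮 * differentIdeal ℤ (𝓞 K))
    (hc : IsCoprime 𝔶 𝔮) :
    conj (charGaussSum 𝔮 χ y) * charGaussSum 𝔮 χ y = (Ideal.absNorm 𝔮 : ℂ) := by
  haveI : Finite (𝓞 K ⧸ 𝔮) := Ideal.finiteQuotientOfFreeOfNeBot 𝔮 h𝔮
  haveI : Fintype (𝓞 K ⧸ 𝔮) := Fintype.ofFinite _
  have hy := mem_dual_of_coeIdeal_eq h𝔮 h𝔶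
  set r : 𝓞 K ⧸ 𝔮 → 𝓞 K := liftNZ K 𝔮 with hr
  have hτ : charGaussSum 𝔮 χ y = ∑ q, unitValue χ q * eTr y (r q) := by
    rw [charGaussSum_eq_sum h𝔮 hy r (mk_liftNZ h𝔮)]
    exact Finset.sum_congr rfl fun q _ => by rw [gaussTerm, hr, mk_liftNZ h𝔮]
  -- `conj τ · τ = ∑_q conj e(r_q y) · (conj χ(q) τ) = ∑_q conj e(r_q y) τ(r_q y)`
  have step1 : conj (charGaussSum 𝔮 χ y) * charGaussSum 𝔮 χ y =
      ∑ q, eTr y (-(r q)) * charGaussSum 𝔮 χ ((r q : K) * y) := by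
    rw [hτ, map_sum, Finset.sum_mul]
    refine Finset.sum_congr rfl fun q _ => ?_
    rw [map_mul, charGaussSum_mul hprim h𝔮 (r q) hy, hr, mk_liftNZ h𝔮, conj_eTr, ← hτ]
    ring
  -- expand `τ(r_q y)` and swap
  have step2 : ∑ q, eTr y (-(r q)) * charGaussSum 𝔮 χ ((r q : K) * y) =
      ∑ q', unitValue χ q' * ∑ q, ((𝐞 ((Algebra.trace ℚ K ((liftNZ K 𝔮 q : K) *
        ((((r q' - 1 : 𝓞 K)) : K) * y)) : ℚ) : ℝ) : Circle) : ℂ) := by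
    have hexp : ∀ q, charGaussSum 𝔮 χ ((r q : K) * y) = ∑ q', unitValue χ q' * eTr ((r q : K) * y) (r q') := by
      intro q
      rw [charGaussSum_eq_sum h𝔮 (coe_mul_mem_dual hy _) r (mk_liftNZ h𝔮)]
      exact Finset.sum_congr rfl fun q' _ => by rw [gaussTerm, hr, mk_liftNZ h𝔮]
    simp_rw [hexp, Finset.mul_sum]
    rw [Finset.sum_comm]
    refine Finset.sum_congr rfl fun q' _ => ?_
    refine Finset.sum_congr rfl fun q _ => ?_
    have : eTr y (-(r q)) * eTr ((r q : K) * y) (r q') =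
        ((𝐞 ((Algebra.trace ℚ K ((liftNZ K 𝔮 q : K) * ((((r q' - 1 : 𝓞 K)) : K) * y)) : ℚ) : ℝ) : Circle) : ℂ) := by
      simp only [eTr, hr]; push_cast
      rw [← Circle.coe_mul, ← AddChar.map_add_eq_mul, ← Rat.cast_add, ← map_add]
      congr 4; ring
    rw [← this]; ring
  have step3 : ∀ q', ∑ q, ((𝐞 ((Algebra.trace ℚ K ((liftNZ K 𝔮 q : K) *
      ((((r q' - 1 : 𝓞 K)) : K) * y)) : ℚ) : ℝ) : Circle) : ℂ) =
      if r q' - 1 ∈ 𝔮 then (Fintype.card (𝓞 K ⧸ 𝔮) : ℂ) else 0 := by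
    intro q'
    split_ifs with hq'
    · exact sum_fourierChar_trace_eq_card h𝔮 ((mul_mem_dual_one_iff h𝔮 h𝔶 hc _).mpr hq')
    · exact sum_fourierChar_trace_eq_zero h𝔮 (coe_mul_mem_dual hy _)
        (fun h => hq' ((mul_mem_dual_one_iff h𝔮 h𝔶 hc _).mp h))
  rw [step1, step2]
  simp_rw [step3, mul_ite, mul_zero]
  rw [Finset.sum_ite, Finset.sum_const_zero, add_zero]
  have hfilter : (Finset.univ.filter fun q' : 𝓞 K ⧸ 𝔮 => r q' - 1 ∈ 𝔮) = {Ideal.Quotient.mk 𝔮 1} := by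
    ext q'
    simp only [Finset.mem_filter, Finset.mem_univ, true_and, Finset.mem_singleton]
    rw [← Ideal.Quotient.eq, hr, mk_liftNZ h𝔮]
  rw [hfilter, Finset.sum_singleton, unitValue_mk_one, one_mul, Ideal.absNorm_apply, Submodule.cardQuot_apply,
    Nat.card_eq_fintype_card]

/-- **`|τ_𝔮(χ, y)|² = N𝔮`**, real form. [cite: NeukirchANT1999, Ch. VII §6 Thm. (6.4)] -/
theorem norm_charGaussSum_sq (hprim : IsPrimitiveChar 𝔮 χ) (h𝔮 : 𝔮 ≠ ⊥) {y : K} {𝔶 : Ideal (𝓞 K)}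
    (h𝔶 : (𝔶 : FractionalIdeal (𝓞 K)⁰ K) = FractionalIdeal.spanSingleton (𝓞 K)⁰ y * 𝔮 * differentIdeal ℤ (𝓞 K))
    (hc : IsCoprime 𝔶 𝔮) :
    ‖charGaussSum 𝔮 χ y‖ ^ 2 = (Ideal.absNorm 𝔮 : ℝ) := by
  have h := normSq_charGaussSum hprim h𝔮 h𝔶 hc
  rw [← Complex.normSq_eq_conj_mul_self, Complex.normSq_eq_norm_sq] at h
  exact_mod_cast h

end Gauss

/-! ## Elements of exact denominator `𝔮` -/

section ExactDenom

variable {𝔮 : Ideal (𝓞 K)}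

/-- **`y ∈ K` has exact denominator `𝔮`**: `y𝔮𝔡` is an integral ideal `𝔶` prime to `𝔮`
(`𝔡` the different); then `y ∈ 𝔮⁻¹𝔡⁻¹` and `zy ∈ 𝔡⁻¹ ⟺ z ∈ 𝔮` — the additive character
`z ↦ e(Tr(zy))` of `𝓞_K/𝔮` is primitive. [cite: NeukirchANT1999, Ch. VII §6 Thm. (6.4)] -/
structure IsExactDenom (𝔮 : Ideal (𝓞 K)) (y : K) : Prop where
  /-- `y𝔮𝔡 = 𝔶` integral and prime to `𝔮`. -/
  exists_ideal : ∃ 𝔶 : Ideal (𝓞 K), (𝔶 : FractionalIdeal (𝓞 K)⁰ K) =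
    FractionalIdeal.spanSingleton (𝓞 K)⁰ y * 𝔮 * differentIdeal ℤ (𝓞 K) ∧ IsCoprime 𝔶 𝔮

/-- An exact-denominator element lies in `𝔮⁻¹𝔡⁻¹`. [folklore] -/
theorem IsExactDenom.mem_dual (h𝔮 : 𝔮 ≠ ⊥) {y : K} (hy : IsExactDenom 𝔮 y) :
    y ∈ FractionalIdeal.dual ℤ ℚ (𝔮 : FractionalIdeal (𝓞 K)⁰ K) := by
  obtain ⟨𝔶, h𝔶, _⟩ := hy.exists_ideal
  exact mem_dual_of_coeIdeal_eq h𝔮 h𝔶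

/-- **`zy ∈ 𝔡⁻¹ ⟺ z ∈ 𝔮`** for `y` of exact denominator `𝔮`. [cite: NeukirchANT1999, Ch. VII §6 Thm. (6.4) (proof)] -/
theorem IsExactDenom.mul_mem_dual_one_iff (h𝔮 : 𝔮 ≠ ⊥) {y : K} (hy : IsExactDenom 𝔮 y) (z : 𝓞 K) :
    (z : K) * y ∈ FractionalIdeal.dual ℤ ℚ (1 : FractionalIdeal (𝓞 K)⁰ K) ↔ z ∈ 𝔮 := by
  obtain ⟨𝔶, h𝔶, hc⟩ := hy.exists_ideal
  exact Literature.NumberTheory.LFunctions.mul_mem_dual_one_iff h𝔮 h𝔶 hc z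

/-- `|τ_𝔮(χ, y)|² = N𝔮` for primitive `χ` and exact-denominator `y`. [cite: NeukirchANT1999, Ch. VII §6 Thm. (6.4)] -/
theorem IsExactDenom.norm_charGaussSum_sq (h𝔮 : 𝔮 ≠ ⊥) {y : K} (hy : IsExactDenom 𝔮 y)
    {χ : AddChar (Additive ((𝓞 K ⧸ 𝔮)ˣ)) ℂ} (hprim : IsPrimitiveChar 𝔮 χ) :
    ‖charGaussSum 𝔮 χ y‖ ^ 2 = (Ideal.absNorm 𝔮 : ℝ) := by
  obtain ⟨𝔶, h𝔶, hc⟩ := hy.exists_ideal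
  exact NumberFieldLS.norm_charGaussSum_sq hprim h𝔮 h𝔶 hc

/-- **Existence of an element of exact denominator `𝔮`** (`𝔮 ≠ 0`): the class of `𝔮⁻¹𝔡⁻¹`
contains an integral ideal `𝔶 = y𝔮𝔡` prime to `𝔮` (the tree's `exists_mem_eltIdeal_isCoprime`,
Neukirch VI (1.9), applied to the integral ideal `N(𝔮𝔡)·(𝔮𝔡)⁻¹`).
[cite: NeukirchANT1999, Ch. VI §1 (1.9) Proposition (proof)] -/
theorem exists_isExactDenom (h𝔮 : 𝔮 ≠ ⊥) : ∃ y : K, IsExactDenom 𝔮 y := by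
  by_cases h𝔮1 : 𝔮 = ⊤
  · refine ⟨1, ⟨differentIdeal ℤ (𝓞 K), ?_, ?_⟩⟩
    · rw [FractionalIdeal.spanSingleton_one, one_mul, h𝔮1, FractionalIdeal.coeIdeal_top, one_mul]
    · rw [h𝔮1, ← Ideal.one_eq_top]; exact isCoprime_one_right
  set J : Ideal (𝓞 K) := 𝔮 * differentIdeal ℤ (𝓞 K) with hJ
  have hJ0 : J ≠ ⊥ := mul_ne_zero h𝔮 differentIdeal_ne_bot'
  set m : ℕ := Ideal.absNorm J with hm
  have hm0 : m ≠ 0 := by rw [hm, Ne, Ideal.absNorm_eq_zero_iff]; exact hJ0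
  have hmmem : ((m : ℕ) : 𝓞 K) ∈ J := Ideal.absNorm_mem J
  obtain ⟨𝔞, h𝔞⟩ : J ∣ Ideal.span {((m : ℕ) : 𝓞 K)} :=
    Ideal.dvd_iff_le.2 ((Ideal.span_singleton_le_iff_mem _).2 hmmem)
  have hm0' : ((m : ℕ) : 𝓞 K) ≠ 0 := by exact_mod_cast hm0
  have h𝔞0 : 𝔞 ≠ ⊥ := by
    rintro rfl
    rw [Ideal.mul_bot, Ideal.span_singleton_eq_bot] at h𝔞
    exact hm0' h𝔞
  obtain ⟨t, ht, ht0, hcop⟩ := exists_mem_eltIdeal_isCoprime h𝔮 h𝔮1 h𝔞0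
  refine ⟨(t : K) / m, ⟨eltIdeal (𝔞 : FractionalIdeal (𝓞 K)⁰ K) t ht, ?_, hcop⟩⟩
  -- `(t𝔞⁻¹) = (t/m) 𝔮 𝔡` since `𝔞 (𝔮𝔡) = (m)`
  have hmK : ((m : ℕ) : K) ≠ 0 := by exact_mod_cast hm0
  have hQD0 : (𝔮 : FractionalIdeal (𝓞 K)⁰ K) * differentIdeal ℤ (𝓞 K) ≠ 0 :=
    mul_ne_zero (coeIdeal_ne_zero' h𝔮) (coeIdeal_differentIdeal_ne_zero (K := K))
  have hcoe : (𝔞 : FractionalIdeal (𝓞 K)⁰ K) * ((𝔮 : FractionalIdeal (𝓞 K)⁰ K) * differentIdeal ℤ (𝓞 K)) =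
      FractionalIdeal.spanSingleton (𝓞 K)⁰ ((m : ℕ) : K) := by
    have := congrArg (fun I : Ideal (𝓞 K) => (I : FractionalIdeal (𝓞 K)⁰ K)) h𝔞
    simp only [FractionalIdeal.coeIdeal_mul, FractionalIdeal.coeIdeal_span_singleton, hJ] at this
    rw [mul_comm, ← this]
    congr 1
  have h𝔞eq : (𝔞 : FractionalIdeal (𝓞 K)⁰ K) =
      FractionalIdeal.spanSingleton (𝓞 K)⁰ ((m : ℕ) : K) * ((𝔮 : FractionalIdeal (𝓞 K)⁰ K) * differentIdeal ℤ (𝓞 K))⁻¹ := by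
    rw [eq_mul_inv_iff_mul_eq₀ hQD0, hcoe]
  have h𝔞inv : ((𝔞 : FractionalIdeal (𝓞 K)⁰ K))⁻¹ =
      FractionalIdeal.spanSingleton (𝓞 K)⁰ (((m : ℕ) : K))⁻¹ * ((𝔮 : FractionalIdeal (𝓞 K)⁰ K) * differentIdeal ℤ (𝓞 K)) := by
    rw [h𝔞eq, mul_inv, inv_inv, FractionalIdeal.spanSingleton_inv]
  rw [coe_eltIdeal, h𝔞inv, ← mul_assoc, ← mul_assoc, FractionalIdeal.spanSingleton_mul_spanSingleton,
    div_eq_mul_inv]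

end ExactDenom

/-! ## The spacing of the Farey points of `K` -/

section Farey

variable {𝔞 𝔮 𝔮' : Ideal (𝓞 K)}

/-- `x w ∈ 𝔡⁻¹` for `x ∈ 𝔮` and `w = u y`, `y ∈ 𝔮⁻¹𝔡⁻¹`. [folklore] -/
theorem coe_mul_mem_dual_one_of_mem (h𝔮 : 𝔮 ≠ ⊥) {y : K}
    (hy : y ∈ FractionalIdeal.dual ℤ ℚ (𝔮 : FractionalIdeal (𝓞 K)⁰ K)) (u : 𝓞 K) {x : 𝓞 K} (hx : x ∈ 𝔮) :
    (x : K) * ((u : K) * y) ∈ FractionalIdeal.dual ℤ ℚ (1 : FractionalIdeal (𝓞 K)⁰ K) := by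
  have h := FractionalIdeal.mul_mem_mul (FractionalIdeal.mem_coeIdeal_of_mem (𝓞 K)⁰ hx) (coe_mul_mem_dual hy u)
  rwa [FractionalIdeal.self_mul_dual ℤ ℚ (coeIdeal_ne_zero' h𝔮)] at h

/-- An element all of whose traces against `𝓞_K` are integers lies in `𝔡⁻¹ = 1^∨`. [folklore] -/
theorem mem_dual_one_of_forall_trace {w : K}
    (h : ∀ x : 𝓞 K, ∃ n : ℤ, (n : ℚ) = Algebra.trace ℚ K ((x : K) * w)) :
    w ∈ FractionalIdeal.dual ℤ ℚ (1 : FractionalIdeal (𝓞 K)⁰ K) := by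
  have h10 : (1 : FractionalIdeal (𝓞 K)⁰ K) ≠ 0 := one_ne_zero
  rw [FractionalIdeal.mem_dual h10]
  intro a ha
  obtain ⟨x, rfl⟩ := (FractionalIdeal.mem_one_iff _).1 ha
  obtain ⟨n, hn⟩ := h x
  refine ⟨n, ?_⟩
  rw [Algebra.traceForm_apply, mul_comm]
  exact_mod_cast hn

/-- Traces against `𝔡⁻¹`-elements are integers. [folklore] -/
theorem exists_int_trace_of_mem_dual_one {w : K}
    (hw : w ∈ FractionalIdeal.dual ℤ ℚ (1 : FractionalIdeal (𝓞 K)⁰ K)) (x : 𝓞 K) :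
    ∃ n : ℤ, (n : ℚ) = Algebra.trace ℚ K ((x : K) * w) := by
  have h10 : (1 : FractionalIdeal (𝓞 K)⁰ K) ≠ 0 := one_ne_zero
  obtain ⟨n, hn⟩ := (FractionalIdeal.mem_dual h10).1 hw (x : K)
    ((FractionalIdeal.mem_one_iff _).2 ⟨x, rfl⟩)
  refine ⟨n, ?_⟩
  rw [Algebra.traceForm_apply, mul_comm] at hn
  exact_mod_cast hn

omit [NumberField K] in
/-- If `u` is a unit `mod 𝔮` and `tu ∈ 𝔮` then `t ∈ 𝔮`. [folklore] -/
theorem mem_of_mul_mem_of_isUnit {u t : 𝓞 K} (hu : IsUnit (Ideal.Quotient.mk 𝔮 u)) (h : t * u ∈ 𝔮) : t ∈ 𝔮 := by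
  have : Ideal.Quotient.mk 𝔮 t * Ideal.Quotient.mk 𝔮 u = 0 := by
    rw [← map_mul, Ideal.Quotient.eq_zero_iff_mem]; exact h
  have ht : Ideal.Quotient.mk 𝔮 t = 0 := by
    have h2 : Ideal.Quotient.mk 𝔮 t * Ideal.Quotient.mk 𝔮 u * ((hu.unit⁻¹ : (𝓞 K ⧸ 𝔮)ˣ) : 𝓞 K ⧸ 𝔮) = 0 := by
      rw [this, zero_mul]
    rwa [mul_assoc, IsUnit.mul_val_inv, mul_one] at h2
  exact Ideal.Quotient.eq_zero_iff_mem.1 ht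

/-- **The difference of two Farey points lies in `(𝔮𝔮'𝔞𝔡)⁻¹`**: for `y ∈ 𝔮⁻¹𝔡⁻¹`,
`y' ∈ 𝔮'⁻¹𝔡⁻¹`, `λ ∈ 𝔞⁻¹` and integers `u, u'`, `uy − u'y' − λ ∈ (𝔮𝔮'𝔞)^∨`. [folklore] -/
theorem sub_sub_mem_dual_mul (h𝔮 : 𝔮 ≠ ⊥) (h𝔮' : 𝔮' ≠ ⊥) (h𝔞 : 𝔞 ≠ ⊥) {y y' : K}
    (hy : y ∈ FractionalIdeal.dual ℤ ℚ (𝔮 : FractionalIdeal (𝓞 K)⁰ K))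
    (hy' : y' ∈ FractionalIdeal.dual ℤ ℚ (𝔮' : FractionalIdeal (𝓞 K)⁰ K)) (u u' : 𝓞 K) {l : K}
    (hl : l ∈ ((𝔞 : FractionalIdeal (𝓞 K)⁰ K))⁻¹) :
    (u : K) * y - (u' : K) * y' - l ∈ FractionalIdeal.dual ℤ ℚ ((𝔮 * 𝔮' * 𝔞 : Ideal (𝓞 K)) : FractionalIdeal (𝓞 K)⁰ K) := by
  have hM0 : ((𝔮 * 𝔮' * 𝔞 : Ideal (𝓞 K)) : FractionalIdeal (𝓞 K)⁰ K) ≠ 0 :=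
    coeIdeal_ne_zero' (mul_ne_zero (mul_ne_zero h𝔮 h𝔮') h𝔞)
  have hsub : ∀ {I : Ideal (𝓞 K)}, I ≠ ⊥ → 𝔮 * 𝔮' * 𝔞 ≤ I →
      FractionalIdeal.dual ℤ ℚ (I : FractionalIdeal (𝓞 K)⁰ K) ≤
        FractionalIdeal.dual ℤ ℚ ((𝔮 * 𝔮' * 𝔞 : Ideal (𝓞 K)) : FractionalIdeal (𝓞 K)⁰ K) := by
    intro I hI hle
    rw [FractionalIdeal.dual_le_dual ℤ ℚ (coeIdeal_ne_zero' hI) hM0]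
    exact (FractionalIdeal.coeIdeal_le_coeIdeal K).2 hle
  refine Submodule.sub_mem _ (Submodule.sub_mem _ ?_ ?_) ?_
  · exact hsub h𝔮 (Ideal.mul_le_right.trans Ideal.mul_le_right) (coe_mul_mem_dual hy u)
  · exact hsub h𝔮' (Ideal.mul_le_right.trans Ideal.mul_le_left) (coe_mul_mem_dual hy' u')
  · refine hsub h𝔞 Ideal.mul_le_left ?_
    exact FractionalIdeal.inv_le_dual ℤ ℚ _ hl

/-- **A nonzero element of `J⁻¹` has norm `≥ N(J)⁻¹`** (`J` a nonzero integral ideal): with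
`m = N(J) ∈ J`, `βm ∈ 𝓞` and `(βm) J ⊆ (m)`, so `m^d ∣ N(βm) N(J) = N(βm) m`. [folklore] -/
theorem inv_absNorm_le_abs_norm_of_mem_inv {J : Ideal (𝓞 K)} (hJ : J ≠ ⊥) {β : K}
    (hβ : β ∈ ((J : FractionalIdeal (𝓞 K)⁰ K))⁻¹) (hβ0 : β ≠ 0) :
    ((Ideal.absNorm J : ℚ))⁻¹ ≤ |Algebra.norm ℚ β| := by
  set m : ℕ := Ideal.absNorm J with hm
  have hm0 : m ≠ 0 := by rw [hm, Ne, Ideal.absNorm_eq_zero_iff]; exact hJ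
  have hmpos : (0 : ℚ) < m := by exact_mod_cast Nat.pos_of_ne_zero hm0
  have hmmem : ((m : ℕ) : 𝓞 K) ∈ J := Ideal.absNorm_mem J
  have hJ' : (J : FractionalIdeal (𝓞 K)⁰ K) ≠ 0 := coeIdeal_ne_zero' hJ
  -- `γ = β m ∈ 𝓞`
  have hβm : β * ((m : ℕ) : K) ∈ (1 : FractionalIdeal (𝓞 K)⁰ K) :=
    (FractionalIdeal.mem_inv_iff hJ').1 hβ _ (FractionalIdeal.mem_coeIdeal_of_mem _ hmmem)
  obtain ⟨γ, hγ⟩ := (FractionalIdeal.mem_one_iff _).1 hβm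
  have hγK : (γ : K) = β * m := hγ
  have hγ0 : γ ≠ 0 := by
    intro h
    rw [h] at hγK; push_cast at hγK
    exact mul_ne_zero hβ0 (by exact_mod_cast hm0) hγK.symm
  -- `(γ) J ≤ (m)`
  have hle : Ideal.span {γ} * J ≤ Ideal.span {((m : ℕ) : 𝓞 K)} := by
    rw [Ideal.mul_le]
    intro g hg j hj
    obtain ⟨c, rfl⟩ := Ideal.mem_span_singleton'.1 hg
    have hβj : β * (j : K) ∈ (1 : FractionalIdeal (𝓞 K)⁰ K) :=
      (FractionalIdeal.mem_inv_iff hJ').1 hβ _ (FractionalIdeal.mem_coeIdeal_of_mem _ hj)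
    obtain ⟨z, hz⟩ := (FractionalIdeal.mem_one_iff _).1 hβj
    have hzK : (z : K) = β * j := hz
    have : c * γ * j = c * z * ((m : ℕ) : 𝓞 K) := by
      apply RingOfIntegers.coe_injective
      push_cast
      linear_combination (c : K) * (j : K) * hγK - (c : K) * ((m : ℕ) : K) * hzK
    rw [this]
    exact Ideal.mul_mem_left _ _ (Ideal.mem_span_singleton_self _)
  have hdvd := Ideal.absNorm_dvd_absNorm_of_le hle
  rw [map_mul, Ideal.absNorm_span_singleton, Ideal.absNorm_span_singleton,
    show ((m : ℕ) : 𝓞 K) = algebraMap ℤ (𝓞 K) (m : ℤ) by simp, Algebra.norm_algebraMap,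
    RingOfIntegers.rank] at hdvd
  -- `m^d ≤ |N γ| m`
  have hne : (Algebra.norm ℤ γ).natAbs * m ≠ 0 :=
    mul_ne_zero (Int.natAbs_ne_zero.2 (Algebra.norm_ne_zero_iff.2 hγ0)) hm0
  have hle2 := Nat.le_of_dvd (Nat.pos_of_ne_zero hne) hdvd
  rw [Int.natAbs_pow, Int.natAbs_natCast] at hle2
  -- translate to `ℚ`
  have hd : 0 < Module.finrank ℚ K := Module.finrank_pos
  have hnormγ : (Algebra.norm ℚ (γ : K)) = ((Algebra.norm ℤ γ : ℤ) : ℚ) := (Algebra.coe_norm_int γ).symm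
  have hnormβ : Algebra.norm ℚ β = Algebra.norm ℚ (γ : K) / (m : ℚ) ^ Module.finrank ℚ K := by
    have h1 : Algebra.norm ℚ ((γ : K)) = Algebra.norm ℚ β * (m : ℚ) ^ Module.finrank ℚ K := by
      rw [hγK, map_mul, show ((m : ℕ) : K) = algebraMap ℚ K (m : ℚ) by simp, Algebra.norm_algebraMap]
    rw [h1, mul_div_cancel_right₀ _ (pow_ne_zero _ hmpos.ne')]
  rw [hnormβ, abs_div, abs_of_pos (pow_pos hmpos _), hnormγ, le_div_iff₀ (pow_pos hmpos _)]
  obtain ⟨d', hd'⟩ := Nat.exists_eq_succ_of_ne_zero hd.ne'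
  rw [hd'] at hle2 ⊢
  have h3 : ((m : ℚ))⁻¹ * (m : ℚ) ^ (d' + 1) = (m : ℚ) ^ d' := by
    rw [pow_succ]; field_simp
  rw [h3]
  have h4 : (m ^ d' : ℕ) ≤ (Algebra.norm ℤ γ).natAbs := by
    rw [pow_succ] at hle2
    exact Nat.le_of_mul_le_mul_right hle2 (Nat.pos_of_ne_zero hm0)
  have h5 : ((m : ℚ)) ^ d' ≤ ((Algebra.norm ℤ γ).natAbs : ℚ) := by exact_mod_cast h4
  refine h5.trans (le_of_eq ?_)
  rw [← Int.cast_abs, Int.abs_eq_natAbs, Int.cast_natCast]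

/-- **Distinct Farey points are distinct modulo `𝔞⁻¹`.** For `𝔮, 𝔮'` prime to `𝔞`, `y_𝔮` of exact
denominator `𝔮` (a fixed choice `𝔮 ↦ y_𝔮`), unit classes `u mod 𝔮`, `u' mod 𝔮'` with
`(𝔮, u) ≠ (𝔮', u')`, and `λ ∈ 𝔞⁻¹`: `u y_𝔮 − u' y_𝔮' ≠ λ` (the character `x ↦ e(Tr(x(uy_𝔮 − u'y_𝔮')))`
would be trivial on `𝔞 + 𝔮𝔮' = 𝓞_K`, forcing `𝔮' ⊆ 𝔮 ⊆ 𝔮'` and `u ≡ u'`). [cite: Huxley1968, §2] -/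
theorem sub_sub_ne_zero (h𝔮 : 𝔮 ≠ ⊥) (h𝔮' : 𝔮' ≠ ⊥) (h𝔞 : 𝔞 ≠ ⊥) (hcop : IsCoprime 𝔮 𝔞)
    (hcop' : IsCoprime 𝔮' 𝔞) (y : Ideal (𝓞 K) → K) (hy : IsExactDenom 𝔮 (y 𝔮)) (hy' : IsExactDenom 𝔮' (y 𝔮'))
    {u u' : 𝓞 K} (hu : IsUnit (Ideal.Quotient.mk 𝔮 u)) (hu' : IsUnit (Ideal.Quotient.mk 𝔮' u'))
    (hne : ∀ h : 𝔮 = 𝔮', u - u' ∉ 𝔮) {l : K} (hl : l ∈ ((𝔞 : FractionalIdeal (𝓞 K)⁰ K))⁻¹) :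
    (u : K) * y 𝔮 - (u' : K) * y 𝔮' - l ≠ 0 := by
  intro h0
  set w : K := (u : K) * y 𝔮 - (u' : K) * y 𝔮' with hw
  have hwl : w = l := by rw [hw]; linear_combination h0
  have hyd := hy.mem_dual h𝔮
  have hyd' := hy'.mem_dual h𝔮'
  -- `w ∈ 𝔡⁻¹`: traces against `𝔞` and against `𝔮𝔮'` are integral, and `𝔞 + 𝔮𝔮' = 1`
  have hcop2 : IsCoprime (𝔮 * 𝔮') 𝔞 := IsCoprime.mul_left hcop hcop'
  have hw1 : w ∈ FractionalIdeal.dual ℤ ℚ (1 : FractionalIdeal (𝓞 K)⁰ K) := by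
    refine mem_dual_one_of_forall_trace fun x => ?_
    have htop : 𝔮 * 𝔮' ⊔ 𝔞 = ⊤ := Ideal.isCoprime_iff_sup_eq.1 hcop2
    have hx : x ∈ 𝔮 * 𝔮' ⊔ 𝔞 := htop ▸ Submodule.mem_top
    obtain ⟨b, hb, a, ha, hba⟩ := Submodule.mem_sup.1 hx
    -- `x = b + a`, `b ∈ 𝔮𝔮'`, `a ∈ 𝔞`
    have hbw : (b : K) * w ∈ FractionalIdeal.dual ℤ ℚ (1 : FractionalIdeal (𝓞 K)⁰ K) := by
      rw [hw, mul_sub]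
      exact Submodule.sub_mem _ (coe_mul_mem_dual_one_of_mem h𝔮 hyd u (Ideal.mul_le_right hb))
        (coe_mul_mem_dual_one_of_mem h𝔮' hyd' u' (Ideal.mul_le_left hb))
    have haw : (a : K) * w ∈ (1 : FractionalIdeal (𝓞 K)⁰ K) := by
      rw [hwl, mul_comm]
      exact (FractionalIdeal.mem_inv_iff (coeIdeal_ne_zero' h𝔞)).1 hl _ (FractionalIdeal.mem_coeIdeal_of_mem _ ha)
    obtain ⟨n₁, hn₁⟩ := exists_int_trace_of_mem_dual_one hbw 1
    have hn₁' : (n₁ : ℚ) = Algebra.trace ℚ K ((b : K) * w) := by simpa using hn₁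
    obtain ⟨z, hz⟩ := (FractionalIdeal.mem_one_iff _).1 haw
    have hz' : ((z : 𝓞 K) : K) = (a : K) * w := hz
    obtain ⟨n₂, hn₂⟩ := IsIntegrallyClosed.isIntegral_iff.mp
      (Algebra.isIntegral_trace (RingOfIntegers.isIntegral_coe z) : IsIntegral ℤ (Algebra.trace ℚ K (z : K)))
    have hn₂' : (n₂ : ℚ) = Algebra.trace ℚ K ((a : K) * w) := by
      rw [← hz']; simpa using hn₂
    refine ⟨n₁ + n₂, ?_⟩
    rw [← hba]
    push_cast
    rw [add_mul, map_add, ← hn₁', ← hn₂']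
  -- `𝔮' ≤ 𝔮` and `𝔮 ≤ 𝔮'`
  have hincl : ∀ {𝔟 𝔟' : Ideal (𝓞 K)} (_ : 𝔟 ≠ ⊥) (h𝔟' : 𝔟' ≠ ⊥) {v v' : 𝓞 K} (_ : IsUnit (Ideal.Quotient.mk 𝔟 v))
      {z z' : K} (hz : IsExactDenom 𝔟 z) (hz' : z' ∈ FractionalIdeal.dual ℤ ℚ (𝔟' : FractionalIdeal (𝓞 K)⁰ K))
      (_ : (v : K) * z - (v' : K) * z' ∈ FractionalIdeal.dual ℤ ℚ (1 : FractionalIdeal (𝓞 K)⁰ K)),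
      𝔟' ≤ 𝔟 := by
    intro 𝔟 𝔟' h𝔟 h𝔟' v v' hv z z' hz hz' hvw t ht
    -- `t v z = t (vz − v'z') + t v' z' ∈ 𝔡⁻¹`, so `t v ∈ 𝔟`, so `t ∈ 𝔟`
    have h1 : (t : K) * ((v : K) * z - (v' : K) * z') ∈ FractionalIdeal.dual ℤ ℚ (1 : FractionalIdeal (𝓞 K)⁰ K) :=
      coe_mul_mem_dual hvw t
    have h2 : (t : K) * ((v' : K) * z') ∈ FractionalIdeal.dual ℤ ℚ (1 : FractionalIdeal (𝓞 K)⁰ K) :=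
      coe_mul_mem_dual_one_of_mem h𝔟' hz' v' ht
    have h3 : (((t * v : 𝓞 K)) : K) * z ∈ FractionalIdeal.dual ℤ ℚ (1 : FractionalIdeal (𝓞 K)⁰ K) := by
      have hsum : (t : K) * ((v : K) * z - (v' : K) * z') + (t : K) * ((v' : K) * z') ∈
          FractionalIdeal.dual ℤ ℚ (1 : FractionalIdeal (𝓞 K)⁰ K) := Submodule.add_mem _ h1 h2
      have heq : (t : K) * ((v : K) * z - (v' : K) * z') + (t : K) * ((v' : K) * z') = (((t * v : 𝓞 K)) : K) * z := by
        push_cast; ring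
      rwa [heq] at hsum
    exact mem_of_mul_mem_of_isUnit hv ((hz.mul_mem_dual_one_iff h𝔟 _).1 h3)
  have hneg : (u' : K) * y 𝔮' - (u : K) * y 𝔮 ∈ FractionalIdeal.dual ℤ ℚ (1 : FractionalIdeal (𝓞 K)⁰ K) := by
    have := Submodule.neg_mem _ hw1
    rw [hw, neg_sub] at this; exact this
  have h1 : 𝔮' ≤ 𝔮 := hincl h𝔮 h𝔮' hu hy hyd' hw1
  have h2 : 𝔮 ≤ 𝔮' := hincl h𝔮' h𝔮 hu' hy' hyd hneg
  have heq : 𝔮 = 𝔮' := le_antisymm h2 h1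
  subst heq
  -- `(u − u') y_𝔮 ∈ 𝔡⁻¹` forces `u ≡ u' mod 𝔮`
  refine hne rfl ((hy.mul_mem_dual_one_iff h𝔮 _).1 ?_)
  push_cast
  rw [sub_mul, ← hw]
  exact hw1

end Farey

/-! ## Gallagher's passage from multiplicative to additive characters -/

section Gallagher

variable {𝔮 : Ideal (𝓞 K)}

omit [NumberField K] in
/-- **Plancherel for the finite abelian group `(𝓞_K/𝔮)ˣ`**:
`∑_χ |∑_u χ(u) b(u)|² = |(𝓞/𝔮)ˣ| ∑_u |b(u)|²`. [folklore] -/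
theorem sum_norm_sq_charSum_eq [Fintype ((𝓞 K ⧸ 𝔮)ˣ)] (b : (𝓞 K ⧸ 𝔮)ˣ → ℂ) :
    ∑ χ : AddChar (Additive ((𝓞 K ⧸ 𝔮)ˣ)) ℂ, ‖∑ u, χ (Additive.ofMul u) * b u‖ ^ 2 =
      Fintype.card ((𝓞 K ⧸ 𝔮)ˣ) * ∑ u, ‖b u‖ ^ 2 := by
  have hC : ∀ z : ℂ, ((‖z‖ ^ 2 : ℝ) : ℂ) = conj z * z := fun z => by
    rw [← Complex.normSq_eq_conj_mul_self, Complex.normSq_eq_norm_sq, Complex.ofReal_pow]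
  apply Complex.ofReal_injective
  simp only [Complex.ofReal_sum, Complex.ofReal_mul, Complex.ofReal_natCast]
  simp_rw [hC, map_sum, map_mul, Finset.sum_mul, Finset.mul_sum]
  -- `∑_χ ∑_u ∑_v conj(χ u b u) χ v b v = ∑_u ∑_v conj b u · b v · ∑_χ χ(v - u)`
  rw [Finset.sum_comm]
  have h1 : ∀ u, ∑ χ : AddChar (Additive ((𝓞 K ⧸ 𝔮)ˣ)) ℂ, ∑ v, conj (χ (Additive.ofMul u)) * conj (b u) *
      (χ (Additive.ofMul v) * b v) = ∑ v, conj (b u) * b v * ∑ χ : AddChar (Additive ((𝓞 K ⧸ 𝔮)ˣ)) ℂ,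
        χ (Additive.ofMul v - Additive.ofMul u) := by
    intro u
    rw [Finset.sum_comm]
    refine Finset.sum_congr rfl fun v _ => ?_
    rw [Finset.mul_sum]
    refine Finset.sum_congr rfl fun χ _ => ?_
    rw [sub_eq_add_neg, AddChar.map_add_eq_mul, AddChar.map_neg_eq_conj]
    ring
  simp_rw [h1, AddChar.sum_apply_eq_ite, sub_eq_zero, Additive.ofMul.apply_eq_iff_eq, mul_ite, mul_zero]
  refine Finset.sum_congr rfl fun u _ => ?_
  rw [Finset.sum_ite_eq' Finset.univ u, if_pos (Finset.mem_univ _),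
    ← Fintype.card_congr (Additive.ofMul (α := (𝓞 K ⧸ 𝔮)ˣ))]
  ring

omit [NumberField K] in
/-- A sum of `χ(q) g(q)` over all classes is the sum over the unit classes. [folklore] -/
theorem sum_unitValue_mul [Fintype (𝓞 K ⧸ 𝔮)] (χ : AddChar (Additive ((𝓞 K ⧸ 𝔮)ˣ)) ℂ)
    (g : 𝓞 K ⧸ 𝔮 → ℂ) :
    ∑ q : 𝓞 K ⧸ 𝔮, unitValue χ q * g q = ∑ u : (𝓞 K ⧸ 𝔮)ˣ, χ (Additive.ofMul u) * g u := by
  have himage : ∑ u : (𝓞 K ⧸ 𝔮)ˣ, χ (Additive.ofMul u) * g u =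
      ∑ q ∈ (Finset.univ : Finset ((𝓞 K ⧸ 𝔮)ˣ)).image (fun u : (𝓞 K ⧸ 𝔮)ˣ => (u : 𝓞 K ⧸ 𝔮)),
        unitValue χ q * g q := by
    rw [Finset.sum_image fun u _ v _ h => Units.val_injective h]
    refine Finset.sum_congr rfl fun u _ => ?_
    rw [unitValue_coe, toMulHom_apply]
  rw [himage]
  symm
  refine Finset.sum_subset (Finset.subset_univ _) fun q _ hq => ?_
  have hqu : ¬ IsUnit q := by
    rintro ⟨u, rfl⟩
    exact hq (Finset.mem_image.2 ⟨u, Finset.mem_univ _, rfl⟩)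
  rw [unitValue_of_not_isUnit χ hqu, zero_mul]

omit [NumberField K] in
/-- The conjugate of a primitive character is primitive. [folklore] -/
theorem IsPrimitiveChar.neg [Finite ((𝓞 K ⧸ 𝔮)ˣ)] {χ : AddChar (Additive ((𝓞 K ⧸ 𝔮)ˣ)) ℂ}
    (h : IsPrimitiveChar 𝔮 χ) : IsPrimitiveChar 𝔮 (-χ) := by
  refine ⟨fun 𝔣 hle hne => ?_⟩
  obtain ⟨b, hb, hb1, hbne⟩ := h.exists_ne_one 𝔣 hle hne
  refine ⟨b, hb, hb1, ?_⟩
  rw [unitValue_neg]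
  exact fun h1 => hbne (by rw [← Complex.conj_conj (unitValue χ _), h1, map_one])

/-- **Gallagher's identity `χ(α) τ(χ̄, y) = ∑_u χ̄(u) e(Tr(α u y))`** for primitive `χ`,
`y ∈ 𝔮⁻¹𝔡⁻¹` and every `α`. [cite: Hinz1988, §3 (3.1)] -/
theorem unitValue_mul_charGaussSum_eq [Fintype (𝓞 K ⧸ 𝔮)] (h𝔮 : 𝔮 ≠ ⊥) {χ : AddChar (Additive ((𝓞 K ⧸ 𝔮)ˣ)) ℂ}
    (hprim : IsPrimitiveChar 𝔮 χ) {y : K} (hy : y ∈ FractionalIdeal.dual ℤ ℚ (𝔮 : FractionalIdeal (𝓞 K)⁰ K))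
    (α : 𝓞 K) :
    unitValue χ (Ideal.Quotient.mk 𝔮 α) * charGaussSum 𝔮 (-χ) y =
      ∑ u : (𝓞 K ⧸ 𝔮)ˣ, (-χ) (Additive.ofMul u) * eTr y (α * liftNZ K 𝔮 u) := by
  haveI : Finite ((𝓞 K ⧸ 𝔮)ˣ) := inferInstance
  have h1 := charGaussSum_mul hprim.neg h𝔮 α hy
  rw [unitValue_neg, Complex.conj_conj] at h1
  rw [← h1, charGaussSum_eq_sum h𝔮 (coe_mul_mem_dual hy α) (liftNZ K 𝔮) (mk_liftNZ h𝔮)]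
  simp only [gaussTerm, mk_liftNZ h𝔮, eTr_mul_left]
  exact sum_unitValue_mul _ _

/-- Gallagher's identity summed against coefficients:
`(∑_α c(α)χ(α)) τ(χ̄, y) = ∑_{u ∈ (𝓞/𝔮)ˣ} χ̄(u) ∑_α c(α) e(Tr(α u y))`. [cite: Hinz1988, §3 (3.1)] -/
theorem sum_mul_charGaussSum_eq [Fintype (𝓞 K ⧸ 𝔮)] (h𝔮 : 𝔮 ≠ ⊥) {χ : AddChar (Additive ((𝓞 K ⧸ 𝔮)ˣ)) ℂ}
    (hprim : IsPrimitiveChar 𝔮 χ) {y : K} (hy : y ∈ FractionalIdeal.dual ℤ ℚ (𝔮 : FractionalIdeal (𝓞 K)⁰ K))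
    (S : Finset (𝓞 K)) (c : 𝓞 K → ℂ) :
    (∑ α ∈ S, c α * unitValue χ (Ideal.Quotient.mk 𝔮 α)) * charGaussSum 𝔮 (-χ) y =
      ∑ u : (𝓞 K ⧸ 𝔮)ˣ, (-χ) (Additive.ofMul u) * ∑ α ∈ S, c α * eTr y (α * liftNZ K 𝔮 u) := by
  rw [Finset.sum_mul]
  simp_rw [mul_assoc, unitValue_mul_charGaussSum_eq h𝔮 hprim hy, Finset.mul_sum]
  rw [Finset.sum_comm]
  refine Finset.sum_congr rfl fun u _ => Finset.sum_congr rfl fun α _ => ?_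
  ring

/-- For primitive `χ`: `N𝔮 |∑_α c(α)χ(α)|² = |∑_u χ̄(u) A(u)|²`, `A(u) = ∑_α c(α)e(Tr(αuy))`
(`|τ(χ̄, y)|² = N𝔮`). [cite: Hinz1988, §3 (3.1)] -/
theorem absNorm_mul_norm_sq_eq [Fintype (𝓞 K ⧸ 𝔮)] (h𝔮 : 𝔮 ≠ ⊥) {y : K} (hy : IsExactDenom 𝔮 y)
    (S : Finset (𝓞 K)) (c : 𝓞 K → ℂ) {χ : AddChar (Additive ((𝓞 K ⧸ 𝔮)ˣ)) ℂ} (hprim : IsPrimitiveChar 𝔮 χ) :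
    (Ideal.absNorm 𝔮 : ℝ) * ‖∑ α ∈ S, c α * unitValue χ (Ideal.Quotient.mk 𝔮 α)‖ ^ 2 =
      ‖∑ u : (𝓞 K ⧸ 𝔮)ˣ, (-χ) (Additive.ofMul u) * ∑ α ∈ S, c α * eTr y (α * liftNZ K 𝔮 u)‖ ^ 2 := by
  haveI : Finite ((𝓞 K ⧸ 𝔮)ˣ) := inferInstance
  have h1 := sum_mul_charGaussSum_eq h𝔮 hprim (hy.mem_dual h𝔮) S c
  have h2 := hy.norm_charGaussSum_sq h𝔮 hprim.neg
  rw [← h1, norm_mul, mul_pow, h2, mul_comm]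

omit [NumberField K] in
/-- `∑_{χ primitive} |∑_u χ̄(u)A(u)|² ≤ ∑_χ |∑_u χ(u) A(u)|²` (drop primitivity, reindex `χ ↦ χ̄`).
[folklore] -/
theorem sum_filter_neg_le_sum [Fintype ((𝓞 K ⧸ 𝔮)ˣ)] (A : (𝓞 K ⧸ 𝔮)ˣ → ℂ) :
    ∑ χ ∈ (Finset.univ : Finset (AddChar (Additive ((𝓞 K ⧸ 𝔮)ˣ)) ℂ)).filter (IsPrimitiveChar 𝔮),
        ‖∑ u, (-χ) (Additive.ofMul u) * A u‖ ^ 2 ≤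
      ∑ χ : AddChar (Additive ((𝓞 K ⧸ 𝔮)ˣ)) ℂ, ‖∑ u, χ (Additive.ofMul u) * A u‖ ^ 2 := by
  calc ∑ χ ∈ Finset.univ.filter (IsPrimitiveChar 𝔮), ‖∑ u, (-χ) (Additive.ofMul u) * A u‖ ^ 2
      ≤ ∑ χ : AddChar (Additive ((𝓞 K ⧸ 𝔮)ˣ)) ℂ, ‖∑ u, (-χ) (Additive.ofMul u) * A u‖ ^ 2 :=
        Finset.sum_le_sum_of_subset_of_nonneg (Finset.filter_subset _ _) fun _ _ _ => by positivity
    _ = ∑ χ : AddChar (Additive ((𝓞 K ⧸ 𝔮)ˣ)) ℂ, ‖∑ u, χ (Additive.ofMul u) * A u‖ ^ 2 :=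
        Fintype.sum_bijective _ (neg_involutive (G := AddChar (Additive ((𝓞 K ⧸ 𝔮)ˣ)) ℂ)).bijective _ _
          fun χ => rfl

/-- **The multiplicative-to-additive step of the large sieve for one modulus** (Gallagher):
for `𝔮 ≠ 0`, `y` of exact denominator `𝔮`, and all `S`, `c`,
`(N𝔮/φ(𝔮)) ∑*_{χ mod 𝔮} |∑_{α∈S} c(α)χ(α)|² ≤ ∑_{u ∈ (𝓞/𝔮)ˣ} |∑_{α∈S} c(α) e(Tr(α u y))|²`
(`|τ(χ̄,y)|² = N𝔮`, `∑* ≤ ∑_χ`, Plancherel). [cite: Hinz1988, §3 (3.1)] -/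
theorem mul_sum_primitive_le [Fintype (𝓞 K ⧸ 𝔮)] (h𝔮 : 𝔮 ≠ ⊥) {y : K} (hy : IsExactDenom 𝔮 y)
    (S : Finset (𝓞 K)) (c : 𝓞 K → ℂ) :
    (Ideal.absNorm 𝔮 : ℝ) / Fintype.card ((𝓞 K ⧸ 𝔮)ˣ) *
        ∑ χ ∈ (Finset.univ : Finset (AddChar (Additive ((𝓞 K ⧸ 𝔮)ˣ)) ℂ)).filter (IsPrimitiveChar 𝔮),
          ‖∑ α ∈ S, c α * unitValue χ (Ideal.Quotient.mk 𝔮 α)‖ ^ 2 ≤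
      ∑ u : (𝓞 K ⧸ 𝔮)ˣ, ‖∑ α ∈ S, c α * eTr y (α * liftNZ K 𝔮 u)‖ ^ 2 := by
  set A : (𝓞 K ⧸ 𝔮)ˣ → ℂ := fun u => ∑ α ∈ S, c α * eTr y (α * liftNZ K 𝔮 u) with hA
  have hcard : (0 : ℝ) < Fintype.card ((𝓞 K ⧸ 𝔮)ˣ) := by exact_mod_cast Fintype.card_pos
  have hsum : (Ideal.absNorm 𝔮 : ℝ) *
      ∑ χ ∈ (Finset.univ : Finset (AddChar (Additive ((𝓞 K ⧸ 𝔮)ˣ)) ℂ)).filter (IsPrimitiveChar 𝔮),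
        ‖∑ α ∈ S, c α * unitValue χ (Ideal.Quotient.mk 𝔮 α)‖ ^ 2 ≤
      Fintype.card ((𝓞 K ⧸ 𝔮)ˣ) * ∑ u, ‖A u‖ ^ 2 := by
    rw [Finset.mul_sum, Finset.sum_congr rfl fun χ hχ' =>
      absNorm_mul_norm_sq_eq h𝔮 hy S c (Finset.mem_filter.1 hχ').2, ← sum_norm_sq_charSum_eq A]
    exact sum_filter_neg_le_sum A
  rw [div_mul_eq_mul_div, div_le_iff₀ hcard]
  calc (Ideal.absNorm 𝔮 : ℝ) * ∑ χ ∈ Finset.univ.filter (IsPrimitiveChar 𝔮),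
        ‖∑ α ∈ S, c α * unitValue χ (Ideal.Quotient.mk 𝔮 α)‖ ^ 2
      ≤ Fintype.card ((𝓞 K ⧸ 𝔮)ˣ) * ∑ u, ‖A u‖ ^ 2 := hsum
    _ = (∑ u, ‖A u‖ ^ 2) * Fintype.card ((𝓞 K ⧸ 𝔮)ˣ) := mul_comm _ _

end Gallagher

/-! ## The large sieve for the characters of `(𝓞_K/𝔮)ˣ`, `N𝔮 ≤ Q` -/

section Assembly

open Module
open Literature.NumberTheory.LFunctions.NumberField (idealsLE mem_idealsLE)

variable (K)

/-- **The `𝔮`-term of the multiplicative large sieve**: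
`(N𝔮/φ(𝔮)) ∑*_{χ mod 𝔮 primitive} |∑_{α ∈ S} c(α) χ(α)|²` (`φ(𝔮) = |(𝓞/𝔮)ˣ|`; the finite sum is
written as a `finsum`, which it is for `𝔮 ≠ 0`, `msTerm_eq`). [cite: Hinz1988, §3 (3.1)] -/
def msTerm (𝔮 : Ideal (𝓞 K)) (S : Finset (𝓞 K)) (c : 𝓞 K → ℂ) : ℝ :=
  (Ideal.absNorm 𝔮 : ℝ) / Nat.card ((𝓞 K ⧸ 𝔮)ˣ) *
    ∑ᶠ χ : AddChar (Additive ((𝓞 K ⧸ 𝔮)ˣ)) ℂ,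
      if IsPrimitiveChar 𝔮 χ then ‖∑ α ∈ S, c α * unitValue χ (Ideal.Quotient.mk 𝔮 α)‖ ^ 2 else 0

/-- Unfolding `msTerm` for `𝔮 ≠ 0`. [folklore] -/
theorem msTerm_eq {𝔮 : Ideal (𝓞 K)} [Fintype (𝓞 K ⧸ 𝔮)] (S : Finset (𝓞 K)) (c : 𝓞 K → ℂ) :
    msTerm K 𝔮 S c = (Ideal.absNorm 𝔮 : ℝ) / Fintype.card ((𝓞 K ⧸ 𝔮)ˣ) *
      ∑ χ ∈ (Finset.univ : Finset (AddChar (Additive ((𝓞 K ⧸ 𝔮)ˣ)) ℂ)).filter (IsPrimitiveChar 𝔮),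
        ‖∑ α ∈ S, c α * unitValue χ (Ideal.Quotient.mk 𝔮 α)‖ ^ 2 := by
  haveI : Finite ((𝓞 K ⧸ 𝔮)ˣ) := inferInstance
  rw [msTerm, finsum_eq_sum_of_fintype, Finset.sum_filter, Nat.card_eq_fintype_card]

/-- `msTerm ≥ 0`. [folklore] -/
theorem msTerm_nonneg (𝔮 : Ideal (𝓞 K)) (S : Finset (𝓞 K)) (c : 𝓞 K → ℂ) : 0 ≤ msTerm K 𝔮 S c := by
  unfold msTerm
  refine mul_nonneg (by positivity) (finsum_nonneg fun χ => ?_)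
  split_ifs <;> positivity

/-- **A system of representatives of `(𝓞_K/𝔮)ˣ` in `𝓞_K`** (`∅` for `𝔮 = 0`). [folklore] -/
def unitReps (𝔮 : Ideal (𝓞 K)) : Finset (𝓞 K) :=
  if h : 𝔮 = ⊥ then ∅ else
    haveI : Finite (𝓞 K ⧸ 𝔮) := Ideal.finiteQuotientOfFreeOfNeBot 𝔮 h
    haveI : Fintype (𝓞 K ⧸ 𝔮) := Fintype.ofFinite _
    (Finset.univ : Finset ((𝓞 K ⧸ 𝔮)ˣ)).image fun u : (𝓞 K ⧸ 𝔮)ˣ => liftNZ K 𝔮 (u : 𝓞 K ⧸ 𝔮)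

variable {K}

/-- `unitReps` for `𝔮 ≠ 0`, with any `Fintype` instance. [folklore] -/
theorem unitReps_eq {𝔮 : Ideal (𝓞 K)} (h𝔮 : 𝔮 ≠ ⊥) [Fintype (𝓞 K ⧸ 𝔮)] :
    unitReps K 𝔮 = (Finset.univ : Finset ((𝓞 K ⧸ 𝔮)ˣ)).image fun u : (𝓞 K ⧸ 𝔮)ˣ => liftNZ K 𝔮 (u : 𝓞 K ⧸ 𝔮) := by
  rw [unitReps, dif_neg h𝔮]
  ext x
  simp only [Finset.mem_image, Finset.mem_univ, true_and]

/-- Members of `unitReps` are units `mod 𝔮`. [folklore] -/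
theorem isUnit_of_mem_unitReps {𝔮 : Ideal (𝓞 K)} (h𝔮 : 𝔮 ≠ ⊥) {x : 𝓞 K} (hx : x ∈ unitReps K 𝔮) :
    IsUnit (Ideal.Quotient.mk 𝔮 x) := by
  haveI : Finite (𝓞 K ⧸ 𝔮) := Ideal.finiteQuotientOfFreeOfNeBot 𝔮 h𝔮
  haveI : Fintype (𝓞 K ⧸ 𝔮) := Fintype.ofFinite _
  rw [unitReps_eq h𝔮, Finset.mem_image] at hx
  obtain ⟨u, -, hu⟩ := hx
  rw [← hu, mk_liftNZ h𝔮]; exact Units.isUnit u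

/-- Distinct members of `unitReps` are incongruent `mod 𝔮`. [folklore] -/
theorem sub_notMem_of_mem_unitReps {𝔮 : Ideal (𝓞 K)} (h𝔮 : 𝔮 ≠ ⊥) {x x' : 𝓞 K}
    (hx : x ∈ unitReps K 𝔮) (hx' : x' ∈ unitReps K 𝔮) (hne : x ≠ x') : x - x' ∉ 𝔮 := by
  haveI : Finite (𝓞 K ⧸ 𝔮) := Ideal.finiteQuotientOfFreeOfNeBot 𝔮 h𝔮
  haveI : Fintype (𝓞 K ⧸ 𝔮) := Fintype.ofFinite _
  rw [unitReps_eq h𝔮, Finset.mem_image] at hx hx'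
  obtain ⟨u, -, hu⟩ := hx
  obtain ⟨u', -, hu'⟩ := hx'
  intro h
  rw [← hu, ← hu', ← Ideal.Quotient.eq, mk_liftNZ h𝔮, mk_liftNZ h𝔮] at h
  exact hne (by rw [← hu, ← hu', Units.val_injective h])

/-- A sum over the unit classes is a sum over `unitReps`. [folklore] -/
theorem sum_units_eq_sum_unitReps {𝔮 : Ideal (𝓞 K)} (h𝔮 : 𝔮 ≠ ⊥) [Fintype (𝓞 K ⧸ 𝔮)] (f : 𝓞 K → ℝ) :
    ∑ u : (𝓞 K ⧸ 𝔮)ˣ, f (liftNZ K 𝔮 u) = ∑ x ∈ unitReps K 𝔮, f x := by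
  rw [unitReps_eq h𝔮]
  symm
  refine Finset.sum_image fun u _ v _ h => ?_
  have := congrArg (Ideal.Quotient.mk 𝔮) h
  rw [mk_liftNZ h𝔮, mk_liftNZ h𝔮] at this
  exact Units.val_injective this

/-- `e(Tr(α (x y))) = eTr y (α x)`. [folklore] -/
theorem e_trace_eq_eTr (y : K) (α x : 𝓞 K) :
    e ((Algebra.trace ℚ K ((α : K) * ((x : K) * y)) : ℚ) : ℝ) = eTr y (α * x) := by
  rw [e_eq_coe_fourierChar, eTr]; push_cast; ring_nf

/-- `|d_K| = N(𝔡) ≥ 1` as a real number. [folklore] -/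
theorem one_le_absNorm_differentIdeal : (1 : ℝ) ≤ (Ideal.absNorm (differentIdeal ℤ (𝓞 K)) : ℝ) := by
  have : Ideal.absNorm (differentIdeal ℤ (𝓞 K)) ≠ 0 := by
    rw [Ne, Ideal.absNorm_eq_zero_iff]; exact differentIdeal_ne_bot'
  exact_mod_cast Nat.one_le_iff_ne_zero.2 this

variable [IsTotallyReal K]

omit [IsTotallyReal K] in
/-- The dual of an integral ideal is the inverse of its product with the different. [folklore] -/
theorem dual_coeIdeal_eq_inv (M : Ideal (𝓞 K)) :
    FractionalIdeal.dual ℤ ℚ (M : FractionalIdeal (𝓞 K)⁰ K) =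
      (((M * differentIdeal ℤ (𝓞 K) : Ideal (𝓞 K)) : FractionalIdeal (𝓞 K)⁰ K))⁻¹ := by
  rw [dual_coeIdeal_eq, FractionalIdeal.coeIdeal_mul, mul_inv]

/-- **The large sieve inequality for the characters of `(𝓞_K/𝔮)ˣ` of a totally real field**
(Hinz 1988, (3.1); Huxley 1968, Theorem 2, for `𝔞 = 𝓞_K`), cube boxes: there is `C = C(K) > 0`
such that for all `Q ≥ 1`, every nonzero ideal `𝔞`, every finite `S ⊆ 𝔞` inside a cube
`|σ_w α − cen_w| ≤ X₀` with `N𝔞 ≤ X₀^d`, and all coefficients `c`,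

  `∑_{N𝔮 ≤ Q, (𝔮,𝔞)=1} (N𝔮/φ(𝔮)) ∑*_{χ mod 𝔮} |∑_{α∈S} c(α)χ(α)|² ≤ C (Q² + X₀^d/N𝔞) ∑_{α∈S}|c(α)|²`.

[cite: Hinz1988, §3 (3.1)] [cite: Huxley1968, Theorem 2] -/
theorem multiplicativeLargeSieve : ∃ C : ℝ, 0 < C ∧ ∀ (Q : ℝ), 1 ≤ Q → ∀ (𝔞 : Ideal (𝓞 K)), 𝔞 ≠ ⊥ →
    ∀ (S : Finset (𝓞 K)), (∀ α ∈ S, α ∈ 𝔞) → ∀ (cen : {w : InfinitePlace K // w.IsReal} → ℝ) (X₀ : ℝ),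
    0 < X₀ → (Ideal.absNorm 𝔞 : ℝ) ≤ X₀ ^ finrank ℚ K →
    (∀ α ∈ S, ∀ k, |remb K (α : K) k - cen k| ≤ X₀) → ∀ (c : 𝓞 K → ℂ),
    ∑ 𝔮 ∈ (idealsLE K Q).filter (fun 𝔮 => IsCoprime 𝔮 𝔞), msTerm K 𝔮 S c ≤
      C * (Q ^ 2 + X₀ ^ finrank ℚ K / Ideal.absNorm 𝔞) * ∑ α ∈ S, ‖c α‖ ^ 2 := by
  obtain ⟨C, hC, hLS⟩ := additiveLargeSieve_cube K
  set D : ℝ := (Ideal.absNorm (differentIdeal ℤ (𝓞 K)) : ℝ) with hD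
  have hD1 : 1 ≤ D := one_le_absNorm_differentIdeal
  set d : ℕ := finrank ℚ K with hd
  have hd0 : 0 < d := finrank_pos
  refine ⟨C * (2 * D + 2), by positivity, ?_⟩
  intro Q hQ 𝔞 h𝔞 S hS cen X₀ hX₀ hN𝔞 hbox c
  have hN𝔞0 : 0 < (Ideal.absNorm 𝔞 : ℝ) := by
    have : Ideal.absNorm 𝔞 ≠ 0 := by rwa [Ne, Ideal.absNorm_eq_zero_iff]
    positivity
  set 𝒬 : Finset (Ideal (𝓞 K)) := (idealsLE K Q).filter (fun 𝔮 => IsCoprime 𝔮 𝔞) with h𝒬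
  have hmem𝒬 : ∀ {𝔮}, 𝔮 ∈ 𝒬 → 𝔮 ≠ ⊥ ∧ (Ideal.absNorm 𝔮 : ℝ) ≤ Q ∧ IsCoprime 𝔮 𝔞 := fun h => by
    rw [h𝒬, Finset.mem_filter, mem_idealsLE] at h
    exact ⟨h.1.1, h.1.2, h.2⟩
  -- exact denominators
  have hy : ∀ 𝔮 : Ideal (𝓞 K), ∃ y : K, 𝔮 ≠ ⊥ → IsExactDenom 𝔮 y := by
    intro 𝔮
    by_cases h : 𝔮 = ⊥
    · exact ⟨0, fun h' => absurd h h'⟩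
    · obtain ⟨y, hy⟩ := exists_isExactDenom h
      exact ⟨y, fun _ => hy⟩
  choose y hy using hy
  -- the per-modulus step
  set F : K → ℝ := fun κ => ‖∑ α ∈ S, c α * e ((Algebra.trace ℚ K ((α : K) * κ) : ℚ) : ℝ)‖ ^ 2 with hF
  have hstep : ∀ 𝔮 ∈ 𝒬, msTerm K 𝔮 S c ≤ ∑ x ∈ unitReps K 𝔮, F ((x : K) * y 𝔮) := by
    intro 𝔮 h𝔮
    obtain ⟨h𝔮0, -, -⟩ := hmem𝒬 h𝔮
    haveI : Finite (𝓞 K ⧸ 𝔮) := Ideal.finiteQuotientOfFreeOfNeBot 𝔮 h𝔮0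
    haveI : Fintype (𝓞 K ⧸ 𝔮) := Fintype.ofFinite _
    rw [msTerm_eq]
    refine (mul_sum_primitive_le h𝔮0 (hy 𝔮 h𝔮0) S c).trans (le_of_eq ?_)
    rw [← sum_units_eq_sum_unitReps h𝔮0 (fun x => F ((x : K) * y 𝔮))]
    refine Finset.sum_congr rfl fun u _ => ?_
    rw [hF]; simp only
    congr 2
    refine Finset.sum_congr rfl fun α _ => ?_
    rw [e_trace_eq_eTr]
  -- the index set of pairs `(𝔮, x)`
  set R : Finset (Ideal (𝓞 K) × 𝓞 K) := (𝒬 ×ˢ 𝒬.biUnion (unitReps K)).filter (fun p => p.2 ∈ unitReps K p.1)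
    with hR
  have hmemR : ∀ {p : Ideal (𝓞 K) × 𝓞 K}, p ∈ R ↔ p.1 ∈ 𝒬 ∧ p.2 ∈ unitReps K p.1 := by
    intro p
    rw [hR, Finset.mem_filter, Finset.mem_product, Finset.mem_biUnion]
    constructor
    · rintro ⟨⟨h1, _⟩, h2⟩; exact ⟨h1, h2⟩
    · rintro ⟨h1, h2⟩; exact ⟨⟨h1, p.1, h1, h2⟩, h2⟩
  have hsumR : ∑ p ∈ R, F ((p.2 : K) * y p.1) = ∑ 𝔮 ∈ 𝒬, ∑ x ∈ unitReps K 𝔮, F ((x : K) * y 𝔮) := by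
    rw [hR, Finset.sum_filter, Finset.sum_product]
    refine Finset.sum_congr rfl fun 𝔮 h𝔮 => ?_
    rw [← Finset.sum_filter]
    refine Finset.sum_congr ?_ fun _ _ => rfl
    ext x
    simp only [Finset.mem_filter, Finset.mem_biUnion]
    exact ⟨fun h => h.2, fun h => ⟨⟨𝔮, h𝔮, h⟩, h⟩⟩
  -- separation of the Farey points
  set T : ℝ := Q ^ 2 * D with hT
  have hT0 : 0 < T := by positivity
  have hsep : ∀ r ∈ R, ∀ r' ∈ R, r ≠ r' → ∀ l ∈ ((𝔞 : FractionalIdeal (𝓞 K)⁰ K))⁻¹,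
      ∃ k, (T * Ideal.absNorm 𝔞) ^ (-(1 / (finrank ℚ K : ℝ))) ≤
        |remb K ((fun p : Ideal (𝓞 K) × 𝓞 K => (p.2 : K) * y p.1) r -
          (fun p : Ideal (𝓞 K) × 𝓞 K => (p.2 : K) * y p.1) r' - l) k| := by
    intro r hr r' hr' hne l hl
    obtain ⟨hr1, hr2⟩ := hmemR.1 hr
    obtain ⟨hr1', hr2'⟩ := hmemR.1 hr'
    obtain ⟨h0, hle, hcop⟩ := hmem𝒬 hr1
    obtain ⟨h0', hle', hcop'⟩ := hmem𝒬 hr1'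
    simp only
    set β : K := (r.2 : K) * y r.1 - (r'.2 : K) * y r'.1 - l with hβ
    -- `β ≠ 0`
    have hβ0 : β ≠ 0 := by
      refine sub_sub_ne_zero h0 h0' h𝔞 hcop hcop' y (hy _ h0) (hy _ h0') (isUnit_of_mem_unitReps h0 hr2)
        (isUnit_of_mem_unitReps h0' hr2') (fun heq => ?_) hl
      have hne2 : r.2 ≠ r'.2 := by
        intro h2; exact hne (Prod.ext heq h2)
      have hr2'' : r'.2 ∈ unitReps K r.1 := by rw [heq]; exact hr2'
      exact sub_notMem_of_mem_unitReps h0 hr2 hr2'' hne2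
    -- `β ∈ (𝔮𝔮'𝔞𝔡)⁻¹`
    have hβmem : β ∈ (((r.1 * r'.1 * 𝔞 * differentIdeal ℤ (𝓞 K) : Ideal (𝓞 K)) : FractionalIdeal (𝓞 K)⁰ K))⁻¹ := by
      rw [← dual_coeIdeal_eq_inv]
      exact sub_sub_mem_dual_mul h0 h0' h𝔞 ((hy _ h0).mem_dual h0) ((hy _ h0').mem_dual h0') _ _ hl
    have hJ0 : r.1 * r'.1 * 𝔞 * differentIdeal ℤ (𝓞 K) ≠ ⊥ :=
      mul_ne_zero (mul_ne_zero (mul_ne_zero h0 h0') h𝔞) differentIdeal_ne_bot'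
    have hnorm := inv_absNorm_le_abs_norm_of_mem_inv hJ0 hβmem hβ0
    -- `|N β| ≥ (T N𝔞)⁻¹`
    have hnormR : (T * Ideal.absNorm 𝔞)⁻¹ ≤ |((Algebra.norm ℚ β : ℚ) : ℝ)| := by
      have h1 : ((Ideal.absNorm (r.1 * r'.1 * 𝔞 * differentIdeal ℤ (𝓞 K)) : ℝ))⁻¹ ≤ |((Algebra.norm ℚ β : ℚ) : ℝ)| := by
        have := hnorm
        rw [← Rat.cast_le (K := ℝ)] at this
        push_cast at this
        exact this
      refine le_trans ?_ h1
      rw [map_mul, map_mul, map_mul]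
      push_cast
      rw [← hD, hT]
      have hq1 : (1 : ℝ) ≤ Ideal.absNorm r.1 := by
        exact_mod_cast Nat.one_le_iff_ne_zero.2 (by rwa [Ne, Ideal.absNorm_eq_zero_iff])
      have hq1' : (1 : ℝ) ≤ Ideal.absNorm r'.1 := by
        exact_mod_cast Nat.one_le_iff_ne_zero.2 (by rwa [Ne, Ideal.absNorm_eq_zero_iff])
      refine inv_anti₀ (by positivity) ?_
      have : (Ideal.absNorm r.1 : ℝ) * Ideal.absNorm r'.1 ≤ Q ^ 2 := by
        rw [sq]; exact mul_le_mul hle hle' (by positivity) (by positivity)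
      calc (Ideal.absNorm r.1 : ℝ) * Ideal.absNorm r'.1 * Ideal.absNorm 𝔞 * D
          ≤ Q ^ 2 * Ideal.absNorm 𝔞 * D := by gcongr
        _ = Q ^ 2 * D * Ideal.absNorm 𝔞 := by ring
    obtain ⟨w, hw⟩ := exists_rpow_le_abs_remb K (le_of_lt (by positivity)) hnormR
    refine ⟨w, le_trans (le_of_eq ?_) hw⟩
    rw [Real.inv_rpow (by positivity), Real.rpow_neg (by positivity)]
  -- apply the additive large sieve
  have hmain := hLS 𝔞 h𝔞 S hS cen X₀ hX₀ hbox R (fun p => (p.2 : K) * y p.1) T hT0 hsep c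
  -- assemble
  have hS0 : 0 ≤ ∑ α ∈ S, ‖c α‖ ^ 2 := Finset.sum_nonneg fun _ _ => by positivity
  calc ∑ 𝔮 ∈ 𝒬, msTerm K 𝔮 S c ≤ ∑ 𝔮 ∈ 𝒬, ∑ x ∈ unitReps K 𝔮, F ((x : K) * y 𝔮) := Finset.sum_le_sum hstep
    _ = ∑ p ∈ R, F ((p.2 : K) * y p.1) := hsumR.symm
    _ ≤ C * (1 + X₀ ^ d / Ideal.absNorm 𝔞) * (1 + T * Ideal.absNorm 𝔞 / X₀ ^ d) * ∑ α ∈ S, ‖c α‖ ^ 2 := hmain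
    _ ≤ C * (2 * D + 2) * (Q ^ 2 + X₀ ^ d / Ideal.absNorm 𝔞) * ∑ α ∈ S, ‖c α‖ ^ 2 := by
        refine mul_le_mul_of_nonneg_right ?_ hS0
        -- `a = X₀^d/N𝔞 ≥ 1`, `T N𝔞 / X₀^d = T/a`
        set a : ℝ := X₀ ^ d / Ideal.absNorm 𝔞 with ha
        have hXd : 0 < X₀ ^ d := by positivity
        have ha1 : 1 ≤ a := by rw [ha, le_div_iff₀ hN𝔞0, one_mul]; exact hN𝔞
        have ha0 : 0 < a := by positivity
        have hTa : T * Ideal.absNorm 𝔞 / X₀ ^ d = T / a := by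
          rw [ha]; field_simp
        have hQ2 : (1 : ℝ) ≤ Q ^ 2 := by nlinarith
        have hkey : (1 + a) * (1 + T * Ideal.absNorm 𝔞 / X₀ ^ d) ≤ (2 * D + 2) * (Q ^ 2 + a) := by
          rw [hTa]
          have h1 : (1 + a) * (1 + T / a) = 1 + a + T / a + T := by field_simp; ring
          have h2 : T / a ≤ T := div_le_self hT0.le ha1
          rw [h1, hT]
          nlinarith [hD1, hQ2, ha1, mul_nonneg (sub_nonneg.2 hQ2) (sub_nonneg.2 hD1),
            mul_nonneg (sub_nonneg.2 ha1) (sub_nonneg.2 hD1)]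
        calc C * (1 + a) * (1 + T * Ideal.absNorm 𝔞 / X₀ ^ d) = C * ((1 + a) * (1 + T * Ideal.absNorm 𝔞 / X₀ ^ d)) := by
              ring
          _ ≤ C * ((2 * D + 2) * (Q ^ 2 + a)) := mul_le_mul_of_nonneg_left hkey hC.le
          _ = C * (2 * D + 2) * (Q ^ 2 + a) := by ring

end Assembly



end Literature.NumberTheory.Sieve.NumberFieldLS
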